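import Summits.BirchSwinnertonDyer.BirchSwinnertonDyer.Theorems.KimAtThreeDeepLowerOffStratumManinPeriod
import Summits.BirchSwinnertonDyer.Rank1Residual.Additive.PotSupersingularTargets
import Literature.NumberTheory.EllipticCurves.ManinConstantConductorLe300000
import HarnessLib

/-!
# Route `KimAtThreeKolyvagin` (rung W2), crux `DeepLowerAtThreeOffKatoStratum` (item 19679): the registered
# stub `stub_additiveDefect` — the ADDITIVE-DEFECT rows — from LOWER-HALF statements BY NAME plus the
# Tamagawa–Manin divisibility of deep Kurihara numbers

Cell `bsd-addord`, seat `bsd-addord-w2-acc3` (PROGRAMME PART 1b, ACCEL-LIST row (3): «K1-leaf socket: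
additive-branch IMC lower bound + Tamagawa-3 divisibility of deep Kurihara numbers»), item
`stmt-BirchSwinnertonDyer-19679`, skeleton `Cruxes/DeepLowerAtThreeOffKatoStratum/Lines/birth.lean`
(`DeepLowerAtThreeOffKatoStratum_of stub_nonAdditive stub_additiveDefect`). Sequel of
`KimAtThreeDeepLowerOffStratumManinPeriod` (general odd `p`). Theorems only (no definition, no named fact,
no `sorry`); every lower-half statement enters as a HYPOTHESIS BY NAME (typed `@[conjecture]` `Prop`s of the
tree or the bodies of K1's route cruxes); nothing asserted, nothing booked; crux 19679 and its stub stay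
OPEN; BSD is not proved.

## The rows, and why one socket covers all three sub-rows

`stub_additiveDefect` = the 19679 row (tower onto, `Ш` finite, lattice-optimal degree-minimal datum `D₀`
at the conductor, `3`-integral plus symbols, `ord(δ̃) = 0`) with `Addv W₀ 3` and
(`3 ∣ c₃` ∨ `#E(ℚ₃)[3] ≠ 1` ∨ `3 ∣ c_{D₀}`); conclusion `∃ d, ∂^{(∞)}_{deep}(δ̃) = d ∧ ∂⁽⁰⁾(δ̃) ≤
ord₃ #Ш(E/ℚ)(3) + d` — the MAIN-CONJECTURE half of `BSD₃` in `∂`-currency. In BSD currency: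
`Ω(W₀) = |c_{D₀}|·Ω⁺_f` exactly, so `∂⁽⁰⁾ = ord₃(L(E,1)/Ω(W₀)) + v₃(c_{D₀})`; `E(ℚ)[3] = 0` under the
tower, so `#E(ℚ₃)[3]` does NOT enter; `c₃ ∣ ∏ c_ℓ`. Hence ALL THREE defects are absorbed by the single
displayed divisibility `v₃(∏ c_ℓ) + v₃(c_{D₀}) ≤ ∂^{(∞)}_{deep}(δ̃_{D₀.f})` («TamManinDiv∞» = Kim 2022 Conj.
1.10 `≥`, deep reading, in Kim's `Ω_E`-normalisation — stated by Kim for `p ∤ c`; on `3 ∣ c_{D₀}` (EMPTY for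
`N ≤ 5·10⁵`, §1) it is the verbatim extension, FORCED given Kato's upper bound, §4; HYPOTHESIS, not fact).

## Contents

* §0 (general odd `p`) `…_of_kimTamagawaDefectGeAt`: n1011's typed all-levels `≥` half `X4.KimTamagawaDefectGeAt`
  as the divisibility on the `p ∤ c_D` sub-rows. §1 `stubAdditiveDefect_row_of_missingLowerBoundAt_of_tamManinDiv`:
  the stub's binders VERBATIM + the two sockets `MissingLowerBoundAt W₀ 3`, TamManinDiv∞ ⟹ conclusion (GZK by
  name); `tamManinDiv_of_tamDiv_of_level_le_500000`: on `N ≤ 500000` (|c_D| = 1 by name, CNS 2023) the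
  Manin exponent vanishes — the `3 ∣ c_{D₀}` sub-row is empty on the census range.
* §2 **`stubAdditiveDefect_of_lowerHalves_of_tamManinDiv`** — THE REGISTERED SIGNATURE of `stub_additiveDefect`,
  token for token, ⟸ GZK, `N10.LowerHalfM` (Delbourgo (M), `v₃(j) < 0`; = K1 crux `MultLower` 19359 at rank
  `0`, `n10LowerHalfM_of_multLower`), `PotGoodLowerHalfRankZero` (`v₃(j) ≥ 0`: ordinary AND supersingular,
  tame and wild — Kato Conj. 12.10 shadow) and TamManinDiv∞ on the additive optimal tower rows; the two lower
  halves cover EVERY additive rank-`0` row by trichotomy on `v₃(j)`. Owner's composition: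
  `DeepLowerAtThreeOffKatoStratum_of h₁ (stubAdditiveDefect_of_lowerHalves_of_tamManinDiv hGZK hM hG hTMD)`.
* §3 the K1-LEAF socket of the ACCEL row (`AdditiveOrdinaryLowerHalf` ∧ GZK ∧ TamManinDiv∞ ⟹ the stub on
  its N10@3 rows; outright off the Tamagawa/Manin defects). §4 NECESSITY on the potentially good rows from
  Kato 2004 Thm. 14.5 (3) by name: there the stub ⟺ TamManinDiv∞.

References: [Kim2022StructureSelmer] §1.5.1, Conj. 1.10, Thm. 1.9 (6); [Kim2025RefinedTNC] Thm. 1.1;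
[MazurRubin2004] Def. 5.2.11, Thm. 5.2.12; [Delbourgo1998] Main Conjecture (p. 151); [Kato2004Asterisque]
Conj. 12.10 (p. 224); [Miller2011LMS] Def. 1.1; [CremonaAlgorithms1997] §2.8.
-/

set_option autoImplicit false
-- the Theorems namespace of a single-conjunct summit repeats the summit name by design (D-0017)
set_option linter.dupNamespace false

noncomputable section

open scoped MatrixGroups ModularForm Classical

open CongruenceSubgroup WeierstrassCurve Literature.NumberTheory.EllipticCurves
  Literature.NumberTheory.EllipticCurves.ModularForms
  Literature.NumberTheory.EllipticCurves.Rank1Residual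
  Literature.NumberTheory.EllipticCurves.Rank1Residual.Typed

namespace Summit.BirchSwinnertonDyer.BirchSwinnertonDyer.Theorems.KimAtThreeDeepLowerOffStratumAdditiveDefect

open Summit.BirchSwinnertonDyer.Rank1Residual
open Summit.BirchSwinnertonDyer.Rank1Residual.Additive
open Summit.BirchSwinnertonDyer.BirchSwinnertonDyer.Theses.KimAtThreeKolyvagin
open Summit.BirchSwinnertonDyer.BirchSwinnertonDyer.Theorems.KimAtThreeKolyvaginUnitLevelOneRungs
open Summit.BirchSwinnertonDyer.BirchSwinnertonDyer.Theorems.KimAtThreeDeepLowerNonAdditiveRows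
open Summit.BirchSwinnertonDyer.BirchSwinnertonDyer.Theorems.KimAtThreeDeepLowerOfAdditiveBranch
open Summit.BirchSwinnertonDyer.BirchSwinnertonDyer.Theorems.KimAtThreeDeepLowerOffStratumManinPeriod

/-- Under the tower (use `n = 1`), `E[3]` is irreducible. [folklore] -/
private theorem irreducible_three_of_tower (W : WeierstrassCurve ℚ) [W.IsElliptic]
    (htower : ∀ n : ℕ, W.HasSurjectiveModNGaloisRep (3 ^ n : ℕ)) :
    W.HasIrreducibleModPGaloisRep 3 :=
  hasIrreducibleModPGaloisRep_of_hasSurjectiveModNGaloisRep W 3 (by simpa using htower 1)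

/-! ### §0 General odd `p`: the typed all-levels `≥` half of Kim's Conjecture 1.10 as the divisibility -/

section General

variable (W : WeierstrassCurve ℚ) [W.IsElliptic] [W.IsGloballyMinimal] (p : ℕ) [Fact p.Prime]
  {N : ℕ} [NeZero N] (D : ModularParametrizationData W N)

/-- **… from cell n1011's typed `≥` half of Kim's Conjecture 1.10 `X4.KimTamagawaDefectGeAt W p D.f`
(ALL levels: `p^{v_p(∏ c_ℓ)}` divides every cyclic-level Kurihara number; by name, as a HYPOTHESIS) on
the sub-rows with `p ∤ c_D`** — all levels ≤ deep (`kuriharaPartialInfty_le_kuriharaPartialDeepInfty`).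
[cite: Kim2022StructureSelmer, Conj. 1.10 (§1.5.3, PDF p. 8)] [cite: MazurRubin2004, Def. 5.2.11] -/
theorem deepLower_conclusion_optimal_of_missingLowerBoundAt_of_kimTamagawaDefectGeAt
    (hGZK : rank_eq_analyticRank_of_analyticRank_le_one) (hp2 : p ≠ 2)
    (hirr : W.HasIrreducibleModPGaloisRep p)
    (hopt : ∀ z ∈ D.L.lattice, ∃ w ∈ periodLattice D.f, z = D.c * w)
    (hord : kuriharaVanishingOrder W p D.f = 0) (hlow : MissingLowerBoundAt W p)
    (hKim : X4.KimTamagawaDefectGeAt W p D.f) (hc : ¬ (p : ℤ) ∣ D.maninConstant) :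
    ∃ d : ℕ, kuriharaPartialDeepInfty W p D.f = d ∧
      kuriharaPartial W p D.f 0 ≤
        ((padicValNat p (Nat.card (AddCommGroup.primaryComponent W.sha p)) + d : ℕ) : ℕ∞) := by
  refine deepLower_conclusion_optimal_of_missingLowerBoundAt_of_tamagawaManin_le_deepInfty W p D hGZK
    hp2 hirr hopt hord hlow ?_
  rw [padicValInt.eq_zero_of_not_dvd hc, Nat.add_zero]
  exact hKim.trans (kuriharaPartialInfty_le_kuriharaPartialDeepInfty W p D.f)

end General

/-! ### §1 One additive-defect row at `p = 3`: the stub's binders verbatim + the two sockets -/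

/-- **The 19679 stub row ⟸ Miller's lower half ∧ TamManinDiv∞.** Binders of `stub_additiveDefect`
VERBATIM (tower, `Ш` finite, `N = N_E`, lattice-optimal degree-minimal `D₀`, integrality, `ord(δ̃) = 0`,
`Addv W₀ 3`, the defect disjunction), then the sockets `MissingLowerBoundAt W₀ 3` (`ord₃ #Ш_an ≤ ord₃ #Ш`)
and `v₃(∏ c_ℓ) + v₃(c_{D₀}) ≤ ∂^{(∞)}_{deep}(δ̃_{D₀.f})`; conclusion verbatim. Granted GZK by name. The
defect disjunction, `Ш` finite, degree-minimality and integrality are carried, not used (the socket is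
uniform in the defect). [cite: Miller2011LMS, Def. 1.1] [cite: Kim2022StructureSelmer, Conj. 1.10 (PDF p. 8), Thm. 1.9 (6)]
[cite: CremonaAlgorithms1997, §2.8 (p. 26)] -/
theorem stubAdditiveDefect_row_of_missingLowerBoundAt_of_tamManinDiv
    (hGZK : rank_eq_analyticRank_of_analyticRank_le_one) :
    ∀ (W₀ : WeierstrassCurve ℚ) [W₀.IsElliptic] [W₀.IsGloballyMinimal],
      (∀ n : ℕ, W₀.HasSurjectiveModNGaloisRep (3 ^ n : ℕ)) → Finite W₀.sha →
      ∀ {N : ℕ} [NeZero N], N = W₀.conductorNorm ℤ →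
      ∀ (D₀ : ModularParametrizationData W₀ N),
        (∀ z ∈ D₀.L.lattice, ∃ w ∈ periodLattice D₀.f, z = D₀.c * w) →
        (∀ (W₂ : WeierstrassCurve ℚ) [W₂.IsElliptic] (D₂ : ModularParametrizationData W₂ N),
          D₂.f = D₀.f → D₀.modularDegree ≤ D₂.modularDegree) →
        (∀ r : ℚ, ratPlusSymbol D₀.f r ≠ 0 → 0 ≤ padicValRat 3 (ratPlusSymbol D₀.f r)) →
        kuriharaVanishingOrder W₀ 3 D₀.f = 0 →
        (haveI : Fact (Nat.Prime 3) := ⟨Nat.prime_three⟩; Addv W₀ 3) →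
        (3 ∣ (W₀.baseChange ℚ_[3]).localTamagawaNumber ℤ_[3] ∨
          Nat.card {Q : (W₀.baseChange ℚ_[3]).toAffine.Point // (3 : ℕ) • Q = 0} ≠ 1 ∨
          (3 : ℤ) ∣ D₀.maninConstant) →
        MissingLowerBoundAt W₀ 3 →
        ((padicValNat 3 W₀.tamagawaProduct + padicValInt 3 D₀.maninConstant : ℕ) : ℕ∞) ≤
          kuriharaPartialDeepInfty W₀ 3 D₀.f →
        ∃ d : ℕ, kuriharaPartialDeepInfty W₀ 3 D₀.f = d ∧
          kuriharaPartial W₀ 3 D₀.f 0 ≤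
            ((padicValNat 3 (Nat.card (AddCommGroup.primaryComponent W₀.sha 3)) + d : ℕ) : ℕ∞) := by
  intro W₀ _ _ htow _ N _ _ D₀ hopt _ _ hord _ _ hlow hdiv
  haveI : Fact (Nat.Prime 3) := ⟨Nat.prime_three⟩
  exact deepLower_conclusion_optimal_of_missingLowerBoundAt_of_tamagawaManin_le_deepInfty W₀ 3 D₀ hGZK
    (by norm_num) (irreducible_three_of_tower W₀ htow) hopt hord hlow hdiv


/-- **On the register range `N ≤ 500000` the Manin exponent VANISHES** (Cremona / Česnavičius–Neururer–Saha:
`|c_D| = 1` for every lattice-optimal datum of level `≤ 500000`, named fact `h5e5`, PUB): there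
TamManinDiv∞ is plain «TamDiv∞» `v₃(∏ c_ℓ) ≤ ∂^{(∞)}_{deep}(δ̃)` and the `3 ∣ c_{D₀}` sub-row of the stub is
EMPTY — so on the whole census range the stub ⟸ {lower halves, TamDiv∞ (deep)}.
[cite: CesnaviciusNeururerSaha2023, §1 p. 2] [cite: Kim2022StructureSelmer, Conj. 1.10 (PDF p. 8)] -/
theorem tamManinDiv_of_tamDiv_of_level_le_500000
    (h5e5 : cremona_abs_maninConstant_eq_one_of_level_le_500000)
    (W : WeierstrassCurve ℚ) [W.IsElliptic] [W.IsGloballyMinimal] {N : ℕ} [NeZero N]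
    (D : ModularParametrizationData W N)
    (hopt : ∀ z ∈ D.L.lattice, ∃ w ∈ periodLattice D.f, z = D.c * w) (hN : N ≤ 500000)
    (hdiv : ((padicValNat 3 W.tamagawaProduct : ℕ) : ℕ∞) ≤ kuriharaPartialDeepInfty W 3 D.f) :
    ((padicValNat 3 W.tamagawaProduct + padicValInt 3 D.maninConstant : ℕ) : ℕ∞) ≤
      kuriharaPartialDeepInfty W 3 D.f := by
  haveI : Fact (Nat.Prime 3) := ⟨Nat.prime_three⟩
  rw [padicValInt_maninConstant_eq_zero_of_level_le_500000 h5e5 W D hopt hN 3, Nat.add_zero]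
  exact hdiv

/-! ### §2 THE REGISTERED STUB from named lower halves covering every additive row -/

/-- **`N10.LowerHalfM` ∧ `PotGoodLowerHalfRankZero` give Miller's lower half at EVERY additive odd prime in
analytic rank `0`** (trichotomy `v_p(j) < 0 ∨ 0 ≤ v_p(j)`: potentially multiplicative ∨ potentially good).
Both hypotheses are typed OPEN `Prop`s of the tree, carried by name; nothing asserted.
[cite: Delbourgo1998, Main Conjecture (p. 151), hypothesis (M) (p. 133)] [cite: Kato2004Asterisque, Conj. 12.10 (p. 224)] -/
theorem missingLowerBoundAt_of_addv_of_lowerHalves (hM : N10.LowerHalfM) (hG : PotGoodLowerHalfRankZero)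
    (W : WeierstrassCurve ℚ) [W.IsElliptic] [W.IsGloballyMinimal] (p : ℕ) [Fact p.Prime] (hp2 : p ≠ 2)
    (hr0 : W.analyticRank = 0) (hA : Addv W p) : MissingLowerBoundAt W p := by
  rcases lt_or_ge (padicValRat p W.j) 0 with hj | hj
  · exact hM W p hr0 ⟨hp2, hA, hj⟩
  · exact hG W p hr0 hp2 hA hj

/-- **THE REGISTERED STUB `stub_additiveDefect` (crux 19679, line `birth`) from named lower halves and the
Tamagawa–Manin divisibility of deep Kurihara numbers.** Conclusion = the registered signature of
`Cruxes.DeepLowerAtThreeOffKatoStratum.Birth.stub_additiveDefect`, token for token. Hypotheses BY NAME: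
GZK; `N10.LowerHalfM` (Delbourgo's (M)-branch main conjecture at `T = 0`, rank `0`; = K1 crux `MultLower`
19359 at rank `0`); `PotGoodLowerHalfRankZero` (Kato Conj. 12.10 shadow at a potentially good additive
prime: ordinary AND supersingular, tame and wild); and TamManinDiv∞ on the additive optimal tower rows of
analytic rank `0` — `v₃(∏ c_ℓ) + v₃(c_{D₀}) ≤ ∂^{(∞)}_{deep}(δ̃_{D₀.f})`, Kim's Conjecture 1.10 (`≥`, deep
reading) for the optimal curve in Kim's normalisation, spelled inline. So the owner's composition
`DeepLowerAtThreeOffKatoStratum_of h₁ (stubAdditiveDefect_of_lowerHalves_of_tamManinDiv hGZK hM hG hTMD)`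
gives crux 19679 GRANTED these names (and acc2's `h₁`). Nothing asserted; every name stays OPEN.
[cite: Kim2022StructureSelmer, Conj. 1.10 (PDF p. 8), Thm. 1.9 (6)] [cite: Delbourgo1998, Main Conjecture (p. 151)]
[cite: Kato2004Asterisque, Conj. 12.10 (p. 224)] [cite: Miller2011LMS, Def. 1.1] -/
theorem stubAdditiveDefect_of_lowerHalves_of_tamManinDiv
    (hGZK : rank_eq_analyticRank_of_analyticRank_le_one)
    (hM : N10.LowerHalfM) (hG : PotGoodLowerHalfRankZero)
    (hTMD : ∀ (W₀ : WeierstrassCurve ℚ) [W₀.IsElliptic] [W₀.IsGloballyMinimal],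
      (∀ n : ℕ, W₀.HasSurjectiveModNGaloisRep (3 ^ n : ℕ)) →
      ∀ {N : ℕ} [NeZero N], N = W₀.conductorNorm ℤ → ∀ (D₀ : ModularParametrizationData W₀ N),
        (∀ z ∈ D₀.L.lattice, ∃ w ∈ periodLattice D₀.f, z = D₀.c * w) →
        (∀ (W₂ : WeierstrassCurve ℚ) [W₂.IsElliptic] (D₂ : ModularParametrizationData W₂ N),
          D₂.f = D₀.f → D₀.modularDegree ≤ D₂.modularDegree) →
        kuriharaVanishingOrder W₀ 3 D₀.f = 0 →
        (haveI : Fact (Nat.Prime 3) := ⟨Nat.prime_three⟩; Addv W₀ 3) →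
        ((padicValNat 3 W₀.tamagawaProduct + padicValInt 3 D₀.maninConstant : ℕ) : ℕ∞) ≤
          kuriharaPartialDeepInfty W₀ 3 D₀.f) :
    ∀ (W₀ : WeierstrassCurve ℚ) [W₀.IsElliptic] [W₀.IsGloballyMinimal],
      (∀ n : ℕ, W₀.HasSurjectiveModNGaloisRep (3 ^ n : ℕ)) → Finite W₀.sha →
      ∀ {N : ℕ} [NeZero N], N = W₀.conductorNorm ℤ →
      ∀ (D₀ : Literature.NumberTheory.EllipticCurves.ModularForms.ModularParametrizationData W₀ N),
        (∀ z ∈ D₀.L.lattice, ∃ w ∈ Literature.NumberTheory.EllipticCurves.ModularForms.periodLattice D₀.f, z = D₀.c * w) →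
        (∀ (W₂ : WeierstrassCurve ℚ) [W₂.IsElliptic]
          (D₂ : Literature.NumberTheory.EllipticCurves.ModularForms.ModularParametrizationData W₂ N),
          D₂.f = D₀.f → D₀.modularDegree ≤ D₂.modularDegree) →
        (∀ r : ℚ, Literature.NumberTheory.EllipticCurves.ratPlusSymbol D₀.f r ≠ 0 →
          0 ≤ padicValRat 3 (Literature.NumberTheory.EllipticCurves.ratPlusSymbol D₀.f r)) →
        Literature.NumberTheory.EllipticCurves.kuriharaVanishingOrder W₀ 3 D₀.f = 0 →
        (haveI : Fact (Nat.Prime 3) := ⟨Nat.prime_three⟩;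
            Literature.NumberTheory.EllipticCurves.Rank1Residual.Addv W₀ 3) →
        (3 ∣ (W₀.baseChange ℚ_[3]).localTamagawaNumber ℤ_[3] ∨
          Nat.card {Q : (W₀.baseChange ℚ_[3]).toAffine.Point // (3 : ℕ) • Q = 0} ≠ 1 ∨
          (3 : ℤ) ∣ D₀.maninConstant) →
        ∃ d : ℕ, Literature.NumberTheory.EllipticCurves.kuriharaPartialDeepInfty W₀ 3 D₀.f = d ∧
          Literature.NumberTheory.EllipticCurves.kuriharaPartial W₀ 3 D₀.f 0 ≤
            ((padicValNat 3 (Nat.card (AddCommGroup.primaryComponent W₀.sha 3)) + d : ℕ) : ℕ∞) := by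
  intro W₀ _ _ htow hfin N _ hN D₀ hopt hdeg hint hord hA hdef
  haveI : Fact (Nat.Prime 3) := ⟨Nat.prime_three⟩
  have hr0 : W₀.analyticRank = 0 :=
    analyticRank_eq_zero_of_kuriharaVanishingOrder_eq_zero W₀ D₀.f D₀.isNewformOf hord
  exact stubAdditiveDefect_row_of_missingLowerBoundAt_of_tamManinDiv hGZK W₀ htow hfin hN D₀ hopt hdeg hint
    hord hA hdef (missingLowerBoundAt_of_addv_of_lowerHalves hM hG W₀ 3 (by norm_num) hr0 hA)
    (hTMD W₀ htow hN D₀ hopt hdeg hord hA)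

/-- **The same with K1's crux `MultLower` (item 19359) BY SHAPE in place of `N10.LowerHalfM`.** The
hypothesis `hMult` is, token for token, the body of `Theses.AdditiveBranchIMC.MultLower`
(`∀ W p, r_an ≤ 1 → N10.CellM W p → MissingLowerBoundAt W p`); it contains `N10.LowerHalfM`. So when K1's
(M) crux closes, the stub is GRANTED {GZK, `PotGoodLowerHalfRankZero`, TamManinDiv∞}.
[cite: Delbourgo1998, Main Conjecture (p. 151), hypothesis (M) (p. 133)] [cite: Kim2022StructureSelmer, Conj. 1.10 (PDF p. 8)] -/
theorem n10LowerHalfM_of_multLower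
    (hMult : ∀ (W : WeierstrassCurve ℚ) [W.IsElliptic] [W.IsGloballyMinimal] (p : ℕ) [Fact p.Prime],
      W.analyticRank ≤ 1 → N10.CellM W p → MissingLowerBoundAt W p) :
    N10.LowerHalfM :=
  fun W _ _ p _ hr hc => hMult W p (by omega) hc

/-! ### §3 The K1-LEAF socket (ACCEL row): `AdditiveOrdinaryLowerHalf` on the N10@3 defect rows -/

/-- **K1's leaf `AdditiveOrdinaryLowerHalf` ∧ GZK ∧ TamManinDiv∞ ⟹ the 19679 stub on its N10@3 rows.**
Stub binders verbatim, then the N10 clause `PotMult W₀ 3 ∨ TypeGOrd W₀ 3` (potentially multiplicative or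
(G)-ordinary `3`: cells (M)@3 and (G-ord, `e = 2`)@3; (G-ord, `e ∈ {3,4,6}`) is empty at `3`) and the
divisibility; conclusion verbatim. The complementary additive rows (potentially supersingular / wild `3`,
cells O5/O6) are outside K1's leaf — use §2 with `PotGoodLowerHalfRankZero`.
[cite: Delbourgo1998, Main Conjecture (p. 151)] [cite: Kim2022StructureSelmer, Conj. 1.10 (PDF p. 8), Thm. 1.9 (6)] -/
theorem stubAdditiveDefect_row_n10_of_additiveOrdinaryLowerHalf_of_tamManinDiv
    (hK1 : AdditiveOrdinaryLowerHalf) (hGZK : rank_eq_analyticRank_of_analyticRank_le_one) :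
    ∀ (W₀ : WeierstrassCurve ℚ) [W₀.IsElliptic] [W₀.IsGloballyMinimal],
      (∀ n : ℕ, W₀.HasSurjectiveModNGaloisRep (3 ^ n : ℕ)) → Finite W₀.sha →
      ∀ {N : ℕ} [NeZero N], N = W₀.conductorNorm ℤ →
      ∀ (D₀ : ModularParametrizationData W₀ N),
        (∀ z ∈ D₀.L.lattice, ∃ w ∈ periodLattice D₀.f, z = D₀.c * w) →
        (∀ (W₂ : WeierstrassCurve ℚ) [W₂.IsElliptic] (D₂ : ModularParametrizationData W₂ N),
          D₂.f = D₀.f → D₀.modularDegree ≤ D₂.modularDegree) →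
        (∀ r : ℚ, ratPlusSymbol D₀.f r ≠ 0 → 0 ≤ padicValRat 3 (ratPlusSymbol D₀.f r)) →
        kuriharaVanishingOrder W₀ 3 D₀.f = 0 →
        (haveI : Fact (Nat.Prime 3) := ⟨Nat.prime_three⟩; Addv W₀ 3) →
        (3 ∣ (W₀.baseChange ℚ_[3]).localTamagawaNumber ℤ_[3] ∨
          Nat.card {Q : (W₀.baseChange ℚ_[3]).toAffine.Point // (3 : ℕ) • Q = 0} ≠ 1 ∨
          (3 : ℤ) ∣ D₀.maninConstant) →
        (PotMult W₀ 3 ∨ TypeGOrd W₀ 3) →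
        ((padicValNat 3 W₀.tamagawaProduct + padicValInt 3 D₀.maninConstant : ℕ) : ℕ∞) ≤
          kuriharaPartialDeepInfty W₀ 3 D₀.f →
        ∃ d : ℕ, kuriharaPartialDeepInfty W₀ 3 D₀.f = d ∧
          kuriharaPartial W₀ 3 D₀.f 0 ≤
            ((padicValNat 3 (Nat.card (AddCommGroup.primaryComponent W₀.sha 3)) + d : ℕ) : ℕ∞) := by
  intro W₀ _ _ htow hfin N _ hN D₀ hopt hdeg hint hord hA hdef hN10 hdiv
  haveI : Fact (Nat.Prime 3) := ⟨Nat.prime_three⟩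
  have hr0 : W₀.analyticRank = 0 :=
    analyticRank_eq_zero_of_kuriharaVanishingOrder_eq_zero W₀ D₀.f D₀.isNewformOf hord
  exact stubAdditiveDefect_row_of_missingLowerBoundAt_of_tamManinDiv hGZK W₀ htow hfin hN D₀ hopt hdeg hint
    hord hA hdef (hK1 W₀ 3 (by rw [hr0]; exact zero_le_one) ⟨by norm_num, hA, hN10⟩) hdiv

/-- **… OUTRIGHT from K1's leaf on the N10@3 defect rows with `3 ∤ ∏ c_ℓ` and `3 ∤ c_{D₀}`** (i.e. the
`#E(ℚ₃)[3] ≠ 1` sub-row off the Tamagawa/Manin defects: local `3`-torsion is invisible to the BSD-currency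
socket). [cite: Delbourgo1998, Main Conjecture (p. 151)] [cite: Miller2011LMS, Def. 1.1] -/
theorem stubAdditiveDefect_row_n10_of_additiveOrdinaryLowerHalf_of_not_dvd
    (hK1 : AdditiveOrdinaryLowerHalf) (hGZK : rank_eq_analyticRank_of_analyticRank_le_one) :
    ∀ (W₀ : WeierstrassCurve ℚ) [W₀.IsElliptic] [W₀.IsGloballyMinimal],
      (∀ n : ℕ, W₀.HasSurjectiveModNGaloisRep (3 ^ n : ℕ)) → Finite W₀.sha →
      ∀ {N : ℕ} [NeZero N], N = W₀.conductorNorm ℤ →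
      ∀ (D₀ : ModularParametrizationData W₀ N),
        (∀ z ∈ D₀.L.lattice, ∃ w ∈ periodLattice D₀.f, z = D₀.c * w) →
        (∀ (W₂ : WeierstrassCurve ℚ) [W₂.IsElliptic] (D₂ : ModularParametrizationData W₂ N),
          D₂.f = D₀.f → D₀.modularDegree ≤ D₂.modularDegree) →
        (∀ r : ℚ, ratPlusSymbol D₀.f r ≠ 0 → 0 ≤ padicValRat 3 (ratPlusSymbol D₀.f r)) →
        kuriharaVanishingOrder W₀ 3 D₀.f = 0 →
        (haveI : Fact (Nat.Prime 3) := ⟨Nat.prime_three⟩; Addv W₀ 3) →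
        (3 ∣ (W₀.baseChange ℚ_[3]).localTamagawaNumber ℤ_[3] ∨
          Nat.card {Q : (W₀.baseChange ℚ_[3]).toAffine.Point // (3 : ℕ) • Q = 0} ≠ 1 ∨
          (3 : ℤ) ∣ D₀.maninConstant) →
        (PotMult W₀ 3 ∨ TypeGOrd W₀ 3) →
        ¬ 3 ∣ W₀.tamagawaProduct → ¬ (3 : ℤ) ∣ D₀.maninConstant →
        ∃ d : ℕ, kuriharaPartialDeepInfty W₀ 3 D₀.f = d ∧
          kuriharaPartial W₀ 3 D₀.f 0 ≤
            ((padicValNat 3 (Nat.card (AddCommGroup.primaryComponent W₀.sha 3)) + d : ℕ) : ℕ∞) := by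
  intro W₀ _ _ htow hfin N _ hN D₀ hopt hdeg hint hord hA hdef hN10 htam hc
  refine stubAdditiveDefect_row_n10_of_additiveOrdinaryLowerHalf_of_tamManinDiv hK1 hGZK W₀ htow hfin hN
    D₀ hopt hdeg hint hord hA hdef hN10 ?_
  haveI : Fact (Nat.Prime 3) := ⟨Nat.prime_three⟩
  rw [padicValNat.eq_zero_of_not_dvd htam, padicValInt.eq_zero_of_not_dvd hc, Nat.add_zero,
    Nat.cast_zero]
  exact zero_le


/-! ### §4 NECESSITY on the potentially good rows: Kato 2004 Thm. 14.5 (3) BY NAME makes the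
Tamagawa–Manin divisibility the exact content of the stub there -/

section Necessity

variable (W : WeierstrassCurve ℚ) [W.IsElliptic] [W.IsGloballyMinimal] {N : ℕ} [NeZero N]
  (D : ModularParametrizationData W N)

/-- **Kato Thm. 14.5 (3) Tamagawa-exact (named fact `hKato`, PUB) ⟹ `ord₃ #Ш(E/ℚ)(3) + v₃(∏ c_ℓ) +
v₃(c_D) ≤ ∂⁽⁰⁾(δ̃_{D.f})`** at a lattice-optimal datum `D` on an ADDITIVE POTENTIALLY-GOOD tower row with
`Ш` finite and `ord(δ̃) = 0` — w2-c5's `sha_add_tamagawa_le_kuriharaPartial_zero_of_kato2004TamagawaExact_of_optimal`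
SHARPENED by the Manin exponent (exact bridge `∂⁽⁰⁾ = ord₃(L(E,1)/Ω(W)) + v₃(c_D)` instead of the one-sided
integral transfer). [cite: Kato2004Asterisque, Thm. 14.5 (3) (p. 236), Prop. 14.16 (2) (p. 244)]
[cite: CremonaAlgorithms1997, §2.8 (p. 26)] [cite: Kim2022StructureSelmer, §1.5.1 (PDF p. 7)] -/
theorem sha_add_tamagawa_add_manin_le_kuriharaPartial_zero_of_kato2004TamagawaExact
    (hKato : Kato2004.rankZero_padicValNat_sha_add_padicValNat_tamagawa_le_of_additive_potGood_of_imageContainsSL2)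
    (htower : ∀ n : ℕ, W.HasSurjectiveModNGaloisRep (3 ^ n : ℕ)) (hfin : Finite W.sha)
    (hopt : ∀ z ∈ D.L.lattice, ∃ w ∈ periodLattice D.f, z = D.c * w)
    (hord : kuriharaVanishingOrder W 3 D.f = 0)
    (hadd : haveI : Fact (Nat.Prime 3) := ⟨Nat.prime_three⟩; Addv W 3) (hpot : 0 ≤ padicValRat 3 W.j) :
    ((padicValNat 3 (Nat.card (AddCommGroup.primaryComponent W.sha 3)) +
        padicValNat 3 W.tamagawaProduct + padicValInt 3 D.maninConstant : ℕ) : ℕ∞) ≤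
      kuriharaPartial W 3 D.f 0 := by
  haveI : Fact (Nat.Prime 3) := ⟨Nat.prime_three⟩
  have hf : IsNewformOf W D.f := D.isNewformOf
  have h0 : ratPlusSymbol D.f 0 ≠ 0 :=
    ratPlusSymbol_zero_ne_zero_of_kuriharaVanishingOrder_eq_zero W 3 D.f hord
  obtain ⟨q, hq, hle⟩ := hKato W 3 (by norm_num) hadd.1 hadd.2 hpot
    (Kato2004.imageContainsSL2_of_forall_hasSurjectiveModNGaloisRep W 3 htower)
    (hf.entireLFunction_one_ne_zero_of_ratPlusSymbol_zero_ne_zero h0) hfin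
  refine natCast_le_kuriharaPartial_zero_of_le_padicValRat_add W 3 D.f (by norm_num)
    (irreducible_three_of_tower W htower) hf h0 (ratCast_abs_maninConstant_ne_zero W D)
    (realPeriodRat_eq_ratCast_abs_maninConstant_mul_plusPeriod W D hopt) hq ?_
  rw [padicValRat_abs_maninConstant W 3 D, Nat.cast_add, Nat.cast_add]
  linarith

/-- **NECESSITY.** On an additive potentially-good tower row (lattice-optimal `D`, `Ш` finite,
`ord(δ̃) = 0`), GRANTED Kato's theorem by name, the 19679 row conclusion `∂⁽⁰⁾ ≤ ord₃ #Ш(3) + ∂^{(∞)}_{deep}`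
FORCES the Tamagawa–Manin divisibility `v₃(∏ c_ℓ) + v₃(c_D) ≤ ∂^{(∞)}_{deep}(δ̃_{D.f})`: the displayed
hypothesis of §§1–3 is the EXACT content of `stub_additiveDefect` on these rows, not a convenience.
[cite: Kato2004Asterisque, Thm. 14.5 (3) (p. 236)] [cite: Kim2022StructureSelmer, Conj. 1.10 (PDF p. 8)] -/
theorem tamManinDiv_of_deepLower_conclusion_potGood_of_kato2004TamagawaExact
    (hKato : Kato2004.rankZero_padicValNat_sha_add_padicValNat_tamagawa_le_of_additive_potGood_of_imageContainsSL2)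
    (htower : ∀ n : ℕ, W.HasSurjectiveModNGaloisRep (3 ^ n : ℕ)) (hfin : Finite W.sha)
    (hopt : ∀ z ∈ D.L.lattice, ∃ w ∈ periodLattice D.f, z = D.c * w)
    (hord : kuriharaVanishingOrder W 3 D.f = 0)
    (hadd : haveI : Fact (Nat.Prime 3) := ⟨Nat.prime_three⟩; Addv W 3) (hpot : 0 ≤ padicValRat 3 W.j)
    (h : ∃ d : ℕ, kuriharaPartialDeepInfty W 3 D.f = d ∧
      kuriharaPartial W 3 D.f 0 ≤
        ((padicValNat 3 (Nat.card (AddCommGroup.primaryComponent W.sha 3)) + d : ℕ) : ℕ∞)) :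
    ((padicValNat 3 W.tamagawaProduct + padicValInt 3 D.maninConstant : ℕ) : ℕ∞) ≤
      kuriharaPartialDeepInfty W 3 D.f := by
  obtain ⟨d, hd, hle⟩ := h
  have hge := sha_add_tamagawa_add_manin_le_kuriharaPartial_zero_of_kato2004TamagawaExact W D hKato htower
    hfin hopt hord hadd hpot
  have h' : padicValNat 3 (Nat.card (AddCommGroup.primaryComponent W.sha 3)) +
        padicValNat 3 W.tamagawaProduct + padicValInt 3 D.maninConstant ≤
      padicValNat 3 (Nat.card (AddCommGroup.primaryComponent W.sha 3)) + d := by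
    exact_mod_cast hge.trans hle
  rw [hd]
  exact_mod_cast (show padicValNat 3 W.tamagawaProduct + padicValInt 3 D.maninConstant ≤ d by omega)

/-- **On the additive potentially-good optimal tower rows the 19679 row conclusion ⟺ TamManinDiv∞**, GRANTED
{Kato Thm. 14.5 (3) (PUB, `hKato`), `PotGoodLowerHalfRankZero` (OPEN, `hG`), GZK} by name. Reading for the
planner: on these rows `stub_additiveDefect` IS Kim's Conjecture 1.10 (`≥`, deep) for the optimal curve —
neither weaker nor stronger — once the lower half is granted. [cite: Kato2004Asterisque, Thm. 14.5 (3) (p. 236)]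
[cite: Kim2022StructureSelmer, Conj. 1.10 (PDF p. 8), Thm. 1.9 (6)] [cite: Miller2011LMS, Def. 1.1] -/
theorem deepLower_conclusion_potGood_iff_tamManinDiv_of_kato_of_potGoodLowerHalf
    (hKato : Kato2004.rankZero_padicValNat_sha_add_padicValNat_tamagawa_le_of_additive_potGood_of_imageContainsSL2)
    (hG : PotGoodLowerHalfRankZero) (hGZK : rank_eq_analyticRank_of_analyticRank_le_one)
    (htower : ∀ n : ℕ, W.HasSurjectiveModNGaloisRep (3 ^ n : ℕ)) (hfin : Finite W.sha)
    (hopt : ∀ z ∈ D.L.lattice, ∃ w ∈ periodLattice D.f, z = D.c * w)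
    (hord : kuriharaVanishingOrder W 3 D.f = 0)
    (hadd : haveI : Fact (Nat.Prime 3) := ⟨Nat.prime_three⟩; Addv W 3) (hpot : 0 ≤ padicValRat 3 W.j) :
    (∃ d : ℕ, kuriharaPartialDeepInfty W 3 D.f = d ∧
      kuriharaPartial W 3 D.f 0 ≤
        ((padicValNat 3 (Nat.card (AddCommGroup.primaryComponent W.sha 3)) + d : ℕ) : ℕ∞)) ↔
    ((padicValNat 3 W.tamagawaProduct + padicValInt 3 D.maninConstant : ℕ) : ℕ∞) ≤
      kuriharaPartialDeepInfty W 3 D.f := by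
  haveI : Fact (Nat.Prime 3) := ⟨Nat.prime_three⟩
  refine ⟨tamManinDiv_of_deepLower_conclusion_potGood_of_kato2004TamagawaExact W D hKato htower hfin hopt
      hord hadd hpot, fun hdiv => ?_⟩
  have hr0 : W.analyticRank = 0 :=
    analyticRank_eq_zero_of_kuriharaVanishingOrder_eq_zero W D.f D.isNewformOf hord
  exact deepLower_conclusion_optimal_of_missingLowerBoundAt_of_tamagawaManin_le_deepInfty W 3 D hGZK
    (by norm_num) (irreducible_three_of_tower W htower) hopt hord (hG W 3 hr0 (by norm_num) hadd hpot) hdiv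

end Necessity

end Summit.BirchSwinnertonDyer.BirchSwinnertonDyer.Theorems.KimAtThreeDeepLowerOffStratumAdditiveDefect

end
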